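import Summits.CriticalPhenomena.SAWScalingLimit.Theorems.SAWBrickWallHomotopyModulusUniversalityLipOfMiddleTV
import Mathlib.Probability.ConditionalProbability
import HarnessLib

/-!
# `ModulusUniversality`, line `birth`: stub L follows from collar non-hitting and ball insensitivity (stub L, layer 6)

Helper file (`--supports stmt-CriticalPhenomena-5790`) of the line `birth` / `registered` for the
crux `SAWBrickWallHomotopy.ModulusUniversality` (skeleton
`Summits/CriticalPhenomena/SAWScalingLimit/Cruxes/ModulusUniversality/Lines/birth.lean`): the
registered helper sub-goal
`stub_jitteredLipMerging_of_collarNonHitting_of_ballInsensitivity` of the open stub L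
(`stub_jitteredLipMerging`), proved — the SPLIT of the middle-block TV merging estimate
`MiddleTV` (the hypothesis of the landed layer `stub_jitteredLipMerging_of_middleTV`, file
`…LipOfMiddleTV.lean`) into two named open lattice estimates, both written out in full as the
two antecedents of the registered signature:

* (M2a) DISPUTED-COLLAR NON-HITTING away from the marked points.  A brick-wall site `x` is
  DISPUTED at mesh `δ` if it lies under a honeycomb vertex `w` (`x = (2w₀ + w₁ + k + 1, w₁)`) and
  some bond at it belongs to exactly one of the two support graphs — the straight one
  `discreteDomainGraph E δ ⊓ SAW.brickWallGraph` (support of the straight law at `t = 0`) and the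
  jittered one `SAW.embDomainGraph hexGraph (B ∘ hexCenter) E δ` read through the site dictionary;
  it is FAR if drawn at distance `≥ ρ` from both marked points.  (M2a): under the straight law
  `SAW.brickWallLaw E δ 0 (a δ) (b δ)` and under the jittered law
  `SAW.embLaw hexGraph (B ∘ hexCenter) E δ x_c (a' δ) (b' δ)`, the probability that the walk
  visits a far disputed site tends to `0` as `δ → 0⁺` (every `ρ > 0`).
* (M2b) BALL-ENVIRONMENT INSENSITIVITY: MiddleTV for the two laws CONDITIONED
  (`ProbabilityTheory.cond`) on the event "no far disputed site is visited": for every `ρ > 0`,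
  `ε > 0`, eventually in `δ`, for every set `A` of site lists, the conditioned straight law of
  `{trim (support) ∈ A}` is at most the conditioned jittered law of
  `{trim (sites under the support) ∈ A}` plus `ε` (`trim` = drop the longest prefix drawn in the
  open `ρ`-ball at `E.pt 0`, then the longest suffix drawn in the open `ρ`-ball at `E.pt 1`).

Both are OPEN (no boundary estimate for the critical self-avoiding walk is known on any
lattice); they are hypotheses here, not asserted.

Proof of `(M2a) ∧ (M2b) → MiddleTV` (then `stub_jitteredLipMerging_of_middleTV`), soft:
* `measure_le_cond_add_compl`: `μ S ≤ μ[|F] S + μ Fᶜ` for a probability measure;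
* `cond_le_measure_add_compl`: `ν[|F] S ≤ ν S + ν Fᶜ` for a probability measure
  (`ν(F ∩ S)/ν F - ν(F ∩ S) ≤ 1 - ν F` because `ν(F ∩ S) ≤ ν F`);
* `isProbabilityMeasure_of_cond_univ_le`: the junk value `0` of the jittered law
  (`embLaw_zero_or_prob`) is excluded by (M2b) at `ε = 1/2`, `A = univ`, once `μ F > 0`;
* `eventually_forall_measure_le_of_cond`: the abstract assembly along a filter — with `F` the
  complement of the (M2a) event, (M2a) makes `μ Fᶜ`, `ν F'ᶜ` eventually `≤ ε/3`, (M2b) at `ε/3`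
  gives the conditioned inequality, and the two bounds above chain to
  `μ S ≤ ν S' + ε/3 + ε/3 + ε/3`.

All bookkeeping tagged [folklore].
-/

noncomputable section

open MeasureTheory Filter Topology
open scoped NNReal ENNReal
open Literature.Probability.LatticeModels
open Literature.Probability.RandomPlanarGeometry

namespace Summit.CriticalPhenomena.SAWScalingLimit.Cruxes.ModulusUniversality.Birth

/-! ### Conditioning bounds (abstract) -/

/-- **Unconditioning, lower side.** For a probability measure `μ` and events `F`, `S`:
`μ S ≤ μ[|F] S + μ Fᶜ` (`μ S = μ (S ∩ F) + μ (S \ F)` and `μ (F ∩ S) ≤ μ (F ∩ S) / μ F` as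
`μ F ≤ 1`). [folklore] -/
theorem measure_le_cond_add_compl {X : Type*} [MeasurableSpace X] (μ : Measure X)
    [IsProbabilityMeasure μ] {F : Set X} (hF : MeasurableSet F) (S : Set X) :
    μ S ≤ ProbabilityTheory.cond μ F S + μ Fᶜ := by
  calc μ S = μ (S ∩ F) + μ (S \ F) := (measure_inter_add_sdiff S hF).symm
    _ ≤ ProbabilityTheory.cond μ F S + μ Fᶜ := by
        refine add_le_add ?_ (measure_mono fun x hx => hx.2)
        rw [ProbabilityTheory.cond_apply hF, Set.inter_comm]
        calc μ (F ∩ S) = 1 * μ (F ∩ S) := (one_mul _).symm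
          _ ≤ (μ F)⁻¹ * μ (F ∩ S) := by
              gcongr
              exact ENNReal.one_le_inv.2 prob_le_one

/-- **Unconditioning, upper side.** For a probability measure `ν` and events `F`, `S`:
`ν[|F] S ≤ ν S + ν Fᶜ`.  With `p = ν F`, `q = ν (F ∩ S) ≤ p ≤ 1`: `q / p ≤ q + (1 - p)` since
`q = q p + q (1 - p) ≤ q p + p (1 - p)`; and `1 - p = ν Fᶜ`, `q ≤ ν S`. [folklore] -/
theorem cond_le_measure_add_compl {Y : Type*} [MeasurableSpace Y] (ν : Measure Y)
    [IsProbabilityMeasure ν] {F : Set Y} (hF : MeasurableSet F) (S : Set Y) :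
    ProbabilityTheory.cond ν F S ≤ ν S + ν Fᶜ := by
  rw [ProbabilityTheory.cond_apply hF, prob_compl_eq_one_sub hF]
  have hqp : ν (F ∩ S) ≤ ν F := measure_mono Set.inter_subset_left
  have hp1 : ν F ≤ 1 := prob_le_one
  have hqS : ν (F ∩ S) ≤ ν S := measure_mono Set.inter_subset_right
  rcases eq_or_ne (ν F) 0 with hp0 | hp0
  · have hq0 : ν (F ∩ S) = 0 := nonpos_iff_eq_zero.1 (hp0 ▸ hqp)
    rw [hq0, mul_zero]
    exact zero_le
  · have hpt : ν F ≠ ∞ := ne_top_of_le_ne_top ENNReal.one_ne_top hp1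
    calc (ν F)⁻¹ * ν (F ∩ S) = ν (F ∩ S) / ν F := by rw [mul_comm, div_eq_mul_inv]
      _ ≤ ν (F ∩ S) + (1 - ν F) := by
          rw [ENNReal.div_le_iff hp0 hpt]
          calc ν (F ∩ S) = ν (F ∩ S) * (ν F + (1 - ν F)) := by
                rw [add_tsub_cancel_of_le hp1, mul_one]
            _ = ν (F ∩ S) * ν F + ν (F ∩ S) * (1 - ν F) := mul_add _ _ _
            _ ≤ ν (F ∩ S) * ν F + ν F * (1 - ν F) := by gcongr
            _ = (ν (F ∩ S) + (1 - ν F)) * ν F := by ring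
      _ ≤ ν S + (1 - ν F) := add_le_add hqS le_rfl

/-- **Excluding the junk value `0`.** If `μ` is a probability measure with `μ F ≠ 0`, `ν` is `0`
or a probability measure, and `μ[|F] univ ≤ ν[|F'] univ + c` for some `c < 1`, then `ν` is a
probability measure (`μ[|F] univ = 1` while `0[|F'] = 0`). [folklore] -/
theorem isProbabilityMeasure_of_cond_univ_le {X Y : Type*} [MeasurableSpace X]
    [MeasurableSpace Y] {μ : Measure X} {ν : Measure Y} [IsProbabilityMeasure μ] {F : Set X}
    (hμF : μ F ≠ 0) (F' : Set Y) (hν : ν = 0 ∨ IsProbabilityMeasure ν) {c : ℝ≥0∞} (hc : c < 1)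
    (h : ProbabilityTheory.cond μ F Set.univ ≤ ProbabilityTheory.cond ν F' Set.univ + c) :
    IsProbabilityMeasure ν := by
  rcases hν with h0 | hν
  · exfalso
    haveI := ProbabilityTheory.cond_isProbabilityMeasure (μ := μ) hμF
    have h7 : ProbabilityTheory.cond ν F' = 0 :=
      ProbabilityTheory.cond_eq_zero_of_meas_eq_zero (by simp [h0])
    rw [h7, Measure.coe_zero, Pi.zero_apply, zero_add, measure_univ] at h
    exact absurd (h.trans_lt hc) (lt_irrefl 1)
  · exact hν

/-- **Abstract assembly: conditioned merging plus vanishing bad events gives merging.**  Along a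
filter `l`, let `μ i` be eventually probability measures on `X i`, `ν i` measures on `Y i` each
of which is `0` or a probability measure, `F i ⊆ X i`, `F' i ⊆ Y i` measurable "good" events
whose complements lie in "bad" events `G i`, `G' i` with `μ i (G i) → 0`, `ν i (G' i) → 0`, and
`T₁ i`, `T₂ i` statistics with values in a common `Z` such that for every `ε > 0`, eventually,
for all `A ⊆ Z`, `μ i [T₁ i ∈ A | F i] ≤ ν i [T₂ i ∈ A | F' i] + ε`.  Then for every `ε > 0`,
eventually, for all `A`, `μ i (T₁ i ∈ A) ≤ ν i (T₂ i ∈ A) + ε`.  Proof: eventually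
`μ i (G i) ≤ min (ε/3, 1/2)` and `ν i (G' i) ≤ ε/3`; then `μ i (F i) ≠ 0`, the conditioned
inequality at `1/2`, `A = univ` makes `ν i` a probability measure
(`isProbabilityMeasure_of_cond_univ_le`), and
`μ S ≤ μ[|F] S + μ Fᶜ ≤ ν[|F'] S' + ε/3 + ε/3 ≤ ν S' + ν F'ᶜ + 2ε/3 ≤ ν S' + ε`
(`measure_le_cond_add_compl`, `cond_le_measure_add_compl`). [folklore] -/
theorem eventually_forall_measure_le_of_cond {ι Z : Type*} {l : Filter ι} {X Y : ι → Type*}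
    [∀ i, MeasurableSpace (X i)] [∀ i, MeasurableSpace (Y i)]
    (μ : ∀ i, Measure (X i)) (ν : ∀ i, Measure (Y i))
    (F G : ∀ i, Set (X i)) (F' G' : ∀ i, Set (Y i)) (T₁ : ∀ i, X i → Z) (T₂ : ∀ i, Y i → Z)
    (hF : ∀ i, MeasurableSet (F i)) (hF' : ∀ i, MeasurableSet (F' i))
    (hFG : ∀ i, (F i)ᶜ ⊆ G i) (hFG' : ∀ i, (F' i)ᶜ ⊆ G' i)
    (hμ : ∀ᶠ i in l, IsProbabilityMeasure (μ i))
    (hν : ∀ i, ν i = 0 ∨ IsProbabilityMeasure (ν i))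
    (hG : Tendsto (fun i => μ i (G i)) l (𝓝 0))
    (hG' : Tendsto (fun i => ν i (G' i)) l (𝓝 0))
    (hcond : ∀ ε : ℝ, 0 < ε → ∀ᶠ i in l, ∀ A : Set Z,
      ProbabilityTheory.cond (μ i) (F i) {x | T₁ i x ∈ A} ≤
        ProbabilityTheory.cond (ν i) (F' i) {y | T₂ i y ∈ A} + ENNReal.ofReal ε)
    {ε : ℝ} (hε : 0 < ε) :
    ∀ᶠ i in l, ∀ A : Set Z,
      μ i {x | T₁ i x ∈ A} ≤ ν i {y | T₂ i y ∈ A} + ENNReal.ofReal ε := by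
  have hε3 : 0 < ε / 3 := by positivity
  have hG3 := ENNReal.tendsto_nhds_zero.1 hG (ENNReal.ofReal (ε / 3)) (ENNReal.ofReal_pos.2 hε3)
  have hG'3 :=
    ENNReal.tendsto_nhds_zero.1 hG' (ENNReal.ofReal (ε / 3)) (ENNReal.ofReal_pos.2 hε3)
  have hGh :=
    ENNReal.tendsto_nhds_zero.1 hG (ENNReal.ofReal (1 / 2)) (ENNReal.ofReal_pos.2 one_half_pos)
  filter_upwards [hμ, hG3, hG'3, hGh, hcond (ε / 3) hε3, hcond (1 / 2) one_half_pos] with i hP h1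
    h2 h3 hA hhalf
  haveI := hP
  -- the first law charges the good event
  have hμF : μ i (F i) ≠ 0 := by
    intro h0
    have h4 : μ i (F i) + μ i (F i)ᶜ = 1 := by
      rw [measure_add_measure_compl (hF i), measure_univ]
    rw [h0, zero_add] at h4
    have h5 : μ i (F i)ᶜ ≤ ENNReal.ofReal (1 / 2) := (measure_mono (hFG i)).trans h3
    rw [h4, ENNReal.one_le_ofReal] at h5
    norm_num at h5
  -- the second law is a probability measure
  haveI hνP : IsProbabilityMeasure (ν i) := by
    refine isProbabilityMeasure_of_cond_univ_le hμF (F' i) (hν i)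
      (c := ENNReal.ofReal (1 / 2)) (ENNReal.ofReal_lt_one.2 (by norm_num)) ?_
    have h6 := hhalf Set.univ
    simpa only [Set.mem_univ, Set.setOf_true] using h6
  intro A
  have hB := cond_le_measure_add_compl (ν i) (hF' i) {y | T₂ i y ∈ A}
  have hε' : ε / 3 + (ε / 3 + ε / 3) = ε := by ring
  calc μ i {x | T₁ i x ∈ A}
      ≤ ProbabilityTheory.cond (μ i) (F i) {x | T₁ i x ∈ A} + μ i (F i)ᶜ :=
        measure_le_cond_add_compl _ (hF i) _
    _ ≤ (ProbabilityTheory.cond (ν i) (F' i) {y | T₂ i y ∈ A} + ENNReal.ofReal (ε / 3)) +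
          ENNReal.ofReal (ε / 3) :=
        add_le_add (hA A) ((measure_mono (hFG i)).trans h1)
    _ ≤ (ν i {y | T₂ i y ∈ A} + ENNReal.ofReal (ε / 3) + ENNReal.ofReal (ε / 3)) +
          ENNReal.ofReal (ε / 3) :=
        add_le_add (add_le_add (hB.trans (add_le_add le_rfl
          ((measure_mono (hFG' i)).trans h2))) le_rfl) le_rfl
    _ = ν i {y | T₂ i y ∈ A} + ENNReal.ofReal ε := by
        rw [add_assoc, add_assoc, ← ENNReal.ofReal_add hε3.le hε3.le,
          ← ENNReal.ofReal_add hε3.le (by positivity), hε']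

/-! ### The registered helper sub-goal -/

/-- **Collar non-hitting and ball insensitivity imply stub L (registered helper sub-goal,
literal signature).**  Notation (all inlined in the signature): `B = diag(2, 2/√3)`; the SITE
under a honeycomb vertex `w = ((w₀, w₁), k)` is the brick-wall site `(2w₀ + w₁ + k + 1, w₁)`; a
brick-wall site `x` is DISPUTED at mesh `δ` if `x = site w` for some `w` and for some `w'` the
bond `{x, site w'}` of the straight support graph `discreteDomainGraph E δ ⊓ SAW.brickWallGraph`
and the bond `{w, w'}` of the jittered support graph `SAW.embDomainGraph hexGraph (B ∘ hexCenter) E δ`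
are not both present or both absent; `x` is FAR if `dist (δ x, E.pt 0) ≥ ρ` and
`dist (δ x, E.pt 1) ≥ ρ`; `trim l` drops from a site list its longest prefix drawn in the open
`ρ`-ball at `E.pt 0` and then its longest suffix drawn in the open `ρ`-ball at `E.pt 1`.
HYPOTHESIS 1 (M2a, disputed-collar non-hitting; OPEN): for every Dobrushin `E`, `ℤ²` endpoint
approximation `(a, b)`, jittered endpoint approximation `(a', b')` and `ρ > 0`, the straight law
`SAW.brickWallLaw E δ 0 (a δ) (b δ)` of "the walk visits a far disputed site" and the jittered law
`SAW.embLaw hexGraph (B ∘ hexCenter) E δ x_c (a' δ) (b' δ)` of "the walk visits a vertex over a far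
disputed site" both tend to `0` as `δ → 0⁺`.  HYPOTHESIS 2 (M2b, ball-environment insensitivity;
OPEN): for the same data with eventually genuine straight law, every `ρ > 0` and `ε > 0`,
eventually in `δ`, for every set `A` of site lists, the straight law CONDITIONED on "no far
disputed site visited" of `{trim (support) ∈ A}` is at most the jittered law conditioned on "no
vertex over a far disputed site visited" of `{trim (sites under the support) ∈ A}` plus `ε`.
CONCLUSION: the text of stub L (`stub_jitteredLipMerging`).  Proof: (M2a) ∧ (M2b) ⇒ MiddleTV by
`eventually_forall_measure_le_of_cond` (good events = "no far disputed site", bad events = the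
(M2a) events, statistics = the trimmed blocks, `embLaw_zero_or_prob` for the jittered law), then
`stub_jitteredLipMerging_of_middleTV` (landed). [folklore] -/
theorem stub_jitteredLipMerging_of_collarNonHitting_of_ballInsensitivity : (∀ B : ℂ ≃ₜ ℂ, (∀ z : ℂ, B z = ((2 * z.re : ℝ) : ℂ) + ((2 / Real.sqrt 3 * z.im : ℝ) : ℂ) * Complex.I) → ∀ (E : DobrushinDomain) (a b : ℝ → Site 2) (a' b' : ℝ → HexVertex), SAW.IsEndpointApprox E a b → SAW.IsEmbEndpointApprox hexGraph (fun v => B (hexCenter v)) E a' b' → ∀ ρ : ℝ, 0 < ρ → Tendsto (fun δ => SAW.brickWallLaw E.carrier δ 0 (a δ) (b δ) {γ | ∃ x ∈ γ.walk.support, (∃ w w' : HexVertex, ![2 * w.1 0 + w.1 1 + ((w.2 : ℕ) : ℤ) + 1, w.1 1] = x ∧ ¬ ((discreteDomainGraph E.carrier δ ⊓ SAW.brickWallGraph).Adj x ![2 * w'.1 0 + w'.1 1 + ((w'.2 : ℕ) : ℤ) + 1, w'.1 1] ↔ (SAW.embDomainGraph hexGraph (fun v => B (hexCenter v)) E.carrier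 δ).Adj w w')) ∧ ∀ i, ρ ≤ dist (meshPoint δ x) (E.pt i)}) (nhdsWithin 0 (Set.Ioi 0)) (nhds 0) ∧ Tendsto (fun δ => SAW.embLaw hexGraph (fun v => B (hexCenter v)) E.carrier δ SAW.hexCriticalFugacity (a' δ) (b' δ) {γ | ∃ x ∈ γ.walk.support.map fun w : HexVertex => (![2 * w.1 0 + w.1 1 + ((w.2 : ℕ) : ℤ) + 1, w.1 1] : Site 2), (∃ w w' : HexVertex, ![2 * w.1 0 + w.1 1 + ((w.2 : ℕ) : ℤ) + 1, w.1 1] = x ∧ ¬ ((discreteDomainGraph E.carrier δ ⊓ SAW.brickWallGraph).Adj x ![2 * w'.1 0 + w'.1 1 + ((w'.2 : ℕ) : ℤ) + 1, w'.1 1] ↔ (SAW.embDomainGraph hexGraph (fun v => B (hexCenter v)) E.carrier δ).Adj w w')) ∧ ∀ i, ρ ≤ dist (meshPoint δ x) (E.pt i)}) (nhdsWithin 0 (Set.Ioi 0)) (nhds 0)) → (∀ B : ℂ ≃ₜ ℂ, (∀ z : ℂ, B z = ((2 * z.re : ℝ) : ℂ) + ((2 / Real.sqrt 3 * z.im : ℝ)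 : ℂ) * Complex.I) → ∀ (E : DobrushinDomain) (a b : ℝ → Site 2) (a' b' : ℝ → HexVertex), SAW.IsEndpointApprox E a b → (∀ᶠ δ in nhdsWithin 0 (Set.Ioi 0), IsProbabilityMeasure (SAW.brickWallLaw E.carrier δ 0 (a δ) (b δ))) → SAW.IsEmbEndpointApprox hexGraph (fun v => B (hexCenter v)) E a' b' → ∀ ρ : ℝ, 0 < ρ → ∀ ε : ℝ, 0 < ε → ∀ᶠ δ in nhdsWithin 0 (Set.Ioi 0), ∀ A : Set (List (Site 2)), ProbabilityTheory.cond (SAW.brickWallLaw E.carrier δ 0 (a δ) (b δ)) {γ | ∀ x ∈ γ.walk.support, (∀ i, ρ ≤ dist (meshPoint δ x) (E.pt i)) → ¬ (∃ w w' : HexVertex, ![2 * w.1 0 + w.1 1 + ((w.2 : ℕ) : ℤ) + 1, w.1 1] = x ∧ ¬ ((discreteDomainGraph E.carrier δ ⊓ SAW.brickWallGraph).Adj x ![2 * w'.1 0 + w'.1 1 + ((w'.2 : ℕ) : ℤ) + 1, w'.1 1] ↔ (SAW.embDomainGraph hexGraph (fun v => B (hexCenter v)) E.carrier δ).Adj w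 w'))} {γ | ((γ.walk.support.dropWhile fun x => decide (dist (meshPoint δ x) (E.pt 0) < ρ)).rdropWhile fun x => decide (dist (meshPoint δ x) (E.pt 1) < ρ)) ∈ A} ≤ ProbabilityTheory.cond (SAW.embLaw hexGraph (fun v => B (hexCenter v)) E.carrier δ SAW.hexCriticalFugacity (a' δ) (b' δ)) {γ | ∀ x ∈ γ.walk.support.map fun w : HexVertex => (![2 * w.1 0 + w.1 1 + ((w.2 : ℕ) : ℤ) + 1, w.1 1] : Site 2), (∀ i, ρ ≤ dist (meshPoint δ x) (E.pt i)) → ¬ (∃ w w' : HexVertex, ![2 * w.1 0 + w.1 1 + ((w.2 : ℕ) : ℤ) + 1, w.1 1] = x ∧ ¬ ((discreteDomainGraph E.carrier δ ⊓ SAW.brickWallGraph).Adj x ![2 * w'.1 0 + w'.1 1 + ((w'.2 : ℕ) : ℤ) + 1, w'.1 1] ↔ (SAW.embDomainGraph hexGraph (fun v => B (hexCenter v)) E.carrier δ).Adj w w'))} {γ | (((γ.walk.support.map fun w : HexVertex => (![2 * w.1 0 + w.1 1 + ((w.2 : ℕ) : ℤ) + 1, w.1 1] : Site 2)).dropWhile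 fun x => decide (dist (meshPoint δ x) (E.pt 0) < ρ)).rdropWhile fun x => decide (dist (meshPoint δ x) (E.pt 1) < ρ)) ∈ A} + ENNReal.ofReal ε) → ∀ B : ℂ ≃ₜ ℂ, (∀ z : ℂ, B z = ((2 * z.re : ℝ) : ℂ) + ((2 / Real.sqrt 3 * z.im : ℝ) : ℂ) * Complex.I) → ∀ (E : DobrushinDomain) (a b : ℝ → Site 2), SAW.IsEndpointApprox E a b → (∀ᶠ δ in nhdsWithin 0 (Set.Ioi 0), IsProbabilityMeasure (SAW.brickWallLaw E.carrier δ 0 (a δ) (b δ))) → ∃ a' b' : ℝ → HexVertex, SAW.IsEmbEndpointApprox hexGraph (fun v : HexVertex => B (hexCenter v)) E a' b' ∧ ∀ (g : BoundedContinuousFunction (CurveClass ℂ) ℝ) (L : NNReal), LipschitzWith L g → Tendsto (fun δ => (∫ γ, g γ.curve ∂(SAW.brickWallLaw E.carrier δ 0 (a δ) (b δ))) - ∫ γ, g γ.curve ∂(SAW.embLaw hexGraph (fun v : HexVertex => B (hexCenter v)) E.carrier δ SAW.hexCriticalFugacity (a' δ) (b' δ))) (nhdsWithin 0 (Set.Ioi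 0)) (nhds 0) := by
  intro hM2a hM2b
  refine stub_jitteredLipMerging_of_middleTV ?_
  intro B hB E a b a' b' hab hprob hab' ρ hρ ε hε
  obtain ⟨h1, h2⟩ := hM2a B hB E a b a' b' hab hab' ρ hρ
  exact eventually_forall_measure_le_of_cond _ _ _ _ _ _ _ _
    (fun _ => MeasurableSet.of_discrete) (fun _ => MeasurableSet.of_discrete)
    (fun δ γ hγ => by
      by_contra hG
      exact hγ fun x hx hR hD => hG ⟨x, hx, hD, hR⟩)
    (fun δ γ hγ => by
      by_contra hG
      exact hγ fun u hu hR hD => hG ⟨u, hu, hD, hR⟩)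
    hprob
    (fun δ => embLaw_zero_or_prob hexGraph (fun v : HexVertex => B (hexCenter v)) E.carrier δ
      SAW.hexCriticalFugacity (a' δ) (b' δ))
    h1 h2 (hM2b B hB E a b a' b' hab hprob hab' ρ hρ) hε

end Summit.CriticalPhenomena.SAWScalingLimit.Cruxes.ModulusUniversality.Birth

end
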